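import Summits.Ventures.Crystal3D.Bulk.GapTightConnected
import HarnessLib

/-!
# Per-face Gauss–Bonnet rows in the kernel: every oriented face of the tight map of a census
# configuration has angular excess in `[0, 4π]` (`(#F − 2)·π ≤ Σ corners ≤ (#F − 2)·π + 4π`)

HONEST FRAMING. Part of the venture `Summits/Ventures/Crystal3D` (cell `pub-crystal3d`, phase 2;
seat p3). Kernel theorems about an admissible fourteen-ball configuration `c`; nothing here
asserts anything about GAP(1.26). With P-L3(b) L1 proved (`CensusRows.tightConnected`,
`Bulk/GapTightConnected.lean`), Theorem A of `Bulk/RotSysGaussBonnet.lean` applies to the tight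
sub-map itself: every one of ITS faces has nonnegative excess. This file transports that
statement to typer-bulk-2's oriented faces `ofaces c` / corner sums `ofaceAngleSum`
(`Bulk/GapOrientedFaces.lean`):

* `IsGapConfig.faceSum_tightDartsH` / `card_face_tightDartsH` / `excess_tightDartsH` — the
  generic face / corner sum / excess of the tight sub-map at a tight dart `d ↦ q` are the
  oriented face `ofaceOf c q`, its `ofaceAngleSum` and `ofaceAngleSum − (#F − 2)π`
  (`cornerAt = odartGap = ofaceCorner`, `sameCycle_phi_iff_ofaceOf`);
* **`CensusRows.ofaceAngleSum_ge`** — R-GB row: for every `F ∈ ofaces c`,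
  `(#F − 2)·π ≤ ofaceAngleSum c F` (the spherical polygon inequality "angle sum ≥ flat angle
  sum", i.e. area `≥ 0`, for EVERY face of the tight map — proved without knowing that faces
  are discs or convex);
* **`CensusRows.ofaceAngleSum_le`** — and `ofaceAngleSum c F ≤ (#F − 2)·π + 4π` (the excesses
  are nonnegative and total `4π`, `CensusRows.total_excess`).

These are the LP's face rows «area ≥ 0» / «area ≤ 4π» (Musin–Tarasov 2012 §4) as kernel facts
under `CensusRows c`. Lemma L (convexity, perimeter `< 2π`) and the face-size bounds are NOT here.
-/

noncomputable section

namespace Summit.Ventures.Crystal3D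

open Literature.Geometry.DiscreteGeometry Finset Equiv HullRotSys

variable {c : Fin 14 → EuclideanSpace ℝ (Fin 3)}

/-! ## The generic face at a tight dart is the oriented face -/

/-- Membership in the generic face of the tight sub-map, read on index pairs: for tight darts
`d ↦ q`, `d' ↦ q'`, `d' ∈ face d ↔ q' ∈ ofaceOf c q`. -/
theorem IsGapConfig.mem_face_tightDartsH_iff (hc : IsGapConfig c) (hD : intruderDist c < 3 / 2)
    {q q' : Fin 14 × Fin 14} (hq : q ∈ darts c) (hq' : q' ∈ darts c)
    {d d' : ↥(hullDarts (dirSet c))} (hd : d.1 = dirPair c q) (hd' : d'.1 = dirPair c q') :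
    d' ∈ RotSys.face hc.hullRot (inv (dirSet c)) (tightDartsH c) d ↔ q' ∈ ofaceOf c q := by
  have hD3 := hc.sq_lt_three_of_lt hD
  have hper := hc.mem_periodicPts_ofaceSucc hD3 hq
  have hper' := hc.mem_periodicPts_ofaceSucc hD3 hq'
  rw [RotSys.mem_face, hc.sameCycle_phi_iff_ofaceOf hD hq hq' hd hd']
  constructor
  · rintro ⟨-, h⟩
    rw [h]; exact self_mem_ofaceOf hper'
  · intro h
    exact ⟨mem_tightDartsH.2 ⟨q', hq', hd'.symm⟩, (ofaceOf_eq_of_mem hper h).symm⟩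

/-- **The corner sum of the generic face at a tight dart `d ↦ q` is `ofaceAngleSum c (ofaceOf c q)`.**
-/
theorem IsGapConfig.faceSum_tightDartsH (hc : IsGapConfig c) (hD : intruderDist c < 3 / 2)
    {q : Fin 14 × Fin 14} (hq : q ∈ darts c) {d : ↥(hullDarts (dirSet c))}
    (hd : d.1 = dirPair c q) :
    RotSys.faceSum hc.hullRot (inv (dirSet c)) (dartWeight (dirSet c)) (tightDartsH c) d =
      ofaceAngleSum c (ofaceOf c q) := by
  have hD2 : intruderDist c < 2 := by linarith
  have hD3 := hc.sq_lt_three_of_lt hD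
  unfold RotSys.faceSum ofaceAngleSum
  symm
  refine Finset.sum_bij (fun q' hq' => ⟨dirPair c q', hc.dirPair_mem_hullDarts hD
    (hc.ofaceOf_subset_darts hD3 hq hq')⟩) ?_ ?_ ?_ ?_
  · intro q' hq'
    exact (hc.mem_face_tightDartsH_iff hD hq (hc.ofaceOf_subset_darts hD3 hq hq') hd rfl).2 hq'
  · intro q₁ hq₁ q₂ hq₂ h
    have h' := congrArg Subtype.val h
    exact hc.dirPair_injOn hD2 (Finset.mem_coe.2 (hc.ofaceOf_subset_darts hD3 hq hq₁))
      (Finset.mem_coe.2 (hc.ofaceOf_subset_darts hD3 hq hq₂)) h'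
  · intro d' hd'
    obtain ⟨hd'T, -⟩ := RotSys.mem_face.1 hd'
    obtain ⟨q', hq', hq'd⟩ := mem_tightDartsH.1 hd'T
    refine ⟨q', (hc.mem_face_tightDartsH_iff hD hq hq' hd hq'd.symm).1 hd', ?_⟩
    exact Subtype.ext hq'd
  · intro q' hq'
    have hq'd : q' ∈ darts c := hc.ofaceOf_subset_darts hD3 hq hq'
    rw [ofaceCorner_eq]
    have hsw : (inv (dirSet c) ⟨dirPair c q', hc.dirPair_mem_hullDarts hD hq'd⟩).1 =
        dirPair c q'.swap := by rw [inv_apply_val, dirPair_swap]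
    rw [hc.cornerAt_tightDartsH hD (swap_mem_darts hq'd) hsw]
    rfl

/-- The generic face at a tight dart has as many darts as the oriented face. -/
theorem IsGapConfig.card_face_tightDartsH (hc : IsGapConfig c) (hD : intruderDist c < 3 / 2)
    {q : Fin 14 × Fin 14} (hq : q ∈ darts c) {d : ↥(hullDarts (dirSet c))}
    (hd : d.1 = dirPair c q) :
    (RotSys.face hc.hullRot (inv (dirSet c)) (tightDartsH c) d).card = (ofaceOf c q).card := by
  have hD2 : intruderDist c < 2 := by linarith
  have hD3 := hc.sq_lt_three_of_lt hD
  symm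
  refine Finset.card_bij (fun q' hq' => ⟨dirPair c q', hc.dirPair_mem_hullDarts hD
    (hc.ofaceOf_subset_darts hD3 hq hq')⟩) ?_ ?_ ?_
  · intro q' hq'
    exact (hc.mem_face_tightDartsH_iff hD hq (hc.ofaceOf_subset_darts hD3 hq hq') hd rfl).2 hq'
  · intro q₁ hq₁ q₂ hq₂ h
    have h' := congrArg Subtype.val h
    exact hc.dirPair_injOn hD2 (Finset.mem_coe.2 (hc.ofaceOf_subset_darts hD3 hq hq₁))
      (Finset.mem_coe.2 (hc.ofaceOf_subset_darts hD3 hq hq₂)) h'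
  · intro d' hd'
    obtain ⟨hd'T, -⟩ := RotSys.mem_face.1 hd'
    obtain ⟨q', hq', hq'd⟩ := mem_tightDartsH.1 hd'T
    refine ⟨q', (hc.mem_face_tightDartsH_iff hD hq hq' hd hq'd.symm).1 hd', ?_⟩
    exact Subtype.ext hq'd

/-- **The generic excess at a tight dart is the angular excess of the oriented face**:
`excess = ofaceAngleSum c F − (#F − 2)·π`, `F = ofaceOf c q`. -/
theorem IsGapConfig.excess_tightDartsH (hc : IsGapConfig c) (hD : intruderDist c < 3 / 2)
    {q : Fin 14 × Fin 14} (hq : q ∈ darts c) {d : ↥(hullDarts (dirSet c))}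
    (hd : d.1 = dirPair c q) :
    RotSys.excess hc.hullRot (inv (dirSet c)) (dartWeight (dirSet c)) (tightDartsH c) d =
      ofaceAngleSum c (ofaceOf c q) - (((ofaceOf c q).card : ℝ) - 2) * Real.pi := by
  unfold RotSys.excess
  rw [hc.faceSum_tightDartsH hD hq hd, hc.card_face_tightDartsH hD hq hd]

/-! ## The per-face rows -/

/-- **Every oriented face of a connected tight map has nonnegative angular excess**
(`(#F − 2)·π ≤ Σ corners`), for any admissible configuration with `D < 3/2` whose tight graph
is connected: Theorem A of the combinatorial Gauss–Bonnet file. -/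
theorem IsGapConfig.ofaceAngleSum_ge_of_tightConnected (hc : IsGapConfig c)
    (hD : intruderDist c < 3 / 2) (hconn : TightConnected c) {F : Finset (Fin 14 × Fin 14)}
    (hF : F ∈ ofaces c) : ((F.card : ℝ) - 2) * Real.pi ≤ ofaceAngleSum c F := by
  obtain ⟨q, hq, rfl⟩ := mem_ofaces_iff.1 hF
  have hrs : RotSys.IsRotSys hc.hullRot (inv (dirSet c)) := isRotSys
  set d : ↥(hullDarts (dirSet c)) := ⟨dirPair c q, hc.dirPair_mem_hullDarts hD hq⟩ with hdd
  have hdT : d ∈ tightDartsH c := mem_tightDartsH.2 ⟨q, hq, rfl⟩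
  have hK := hc.numK_eq_one_of_tightConnected hD hconn ⟨q, hq⟩
  have h := hrs.excess_nonneg_of_numK_eq_one (dartWeight (dirSet c)) chi2_univ_eq_numK conn_univ
    excess_univ_nonneg cornerAt_singleton_le_two_pi (isClosed_tightDartsH c) hK hdT
  rw [hc.excess_tightDartsH hD hq rfl] at h
  linarith

/-- **R-GB row (lower): every oriented face of a census configuration has angle sum at least
the flat value**, `(#F − 2)·π ≤ ofaceAngleSum c F` — its spherical excess (area) is `≥ 0`. -/
theorem CensusRows.ofaceAngleSum_ge (h : CensusRows c) {F : Finset (Fin 14 × Fin 14)}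
    (hF : F ∈ ofaces c) : ((F.card : ℝ) - 2) * Real.pi ≤ ofaceAngleSum c F :=
  h.isGapConfig.ofaceAngleSum_ge_of_tightConnected h.intruderDist_lt_three_halves h.tightConnected
    hF

/-- **R-GB row (upper): the excess of a single face is at most the total `4π`**:
`ofaceAngleSum c F ≤ (#F − 2)·π + 4π`. -/
theorem CensusRows.ofaceAngleSum_le (h : CensusRows c) {F : Finset (Fin 14 × Fin 14)}
    (hF : F ∈ ofaces c) : ofaceAngleSum c F ≤ ((F.card : ℝ) - 2) * Real.pi + 4 * Real.pi := by
  have htot := h.total_excess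
  have hle : ofaceAngleSum c F - ((F.card : ℝ) - 2) * Real.pi ≤
      ∑ F' ∈ ofaces c, (ofaceAngleSum c F' - ((F'.card : ℝ) - 2) * Real.pi) :=
    Finset.single_le_sum (f := fun F' => ofaceAngleSum c F' - ((F'.card : ℝ) - 2) * Real.pi)
      (fun F' hF' => by have := h.ofaceAngleSum_ge hF'; linarith) hF
  linarith

end Summit.Ventures.Crystal3D
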